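import Literature.NumberTheory.GelbartRogawski1991.FiniteAdelicWeilCentralCoinvariants
import Literature.RepresentationTheory.TwistedCoinvariantsIrreducible
import HarnessLib

/-!
# A restricted tensor product with a ZERO factor is zero — the central coinvariants of `⊗'_v ω_v` vanish as soon as
# ONE local central quotient vanishes ([Liu2021, Def. 4.11] `ω(μ, ε, χ) := ⊗'_v ω(μ_v, ε_v, χ_v)` with App. D
# Lem. D.1 (1): at `n = 2` a local factor may be zero)

Topic `NumberTheory/GelbartRogawski1991`; namespaces `Literature.NumberTheory.Automorphic` (§1–§2, generic) and
`Literature.NumberTheory.GelbartRogawski1991.UnitaryDualPair.LocalSplitting.FinLocalSplittings` (§3, the Weil instance).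
Theorems only: no definition, no named fact, no `sorry`.  The ZERO twin of the tree's
`FiniteAdelicWeilCentralCoinvariantsIrreducible.lean` (`omegaPi_centralCoinv_isIrreducible`,
`omega_centralCoinv_isIrreducible`: ALL local quotients irreducible admissible ⇒ global quotient irreducible, [Flath1979]):
here ONE local quotient zero ⇒ global quotient zero.  Together they read [Liu2021, Def. 4.11]'s «irreducible» at
rank `n = 2` correctly as «irreducible OR ZERO» (Liu's own reading, App. D Lem. D.1 first sentence + (1), l. 5227–5229:
the local `ω(μ_v, ε_v, χ_v)` «is zero if and only if `E_v` is a field, `V_v` is anisotropic (in particular `n = 2`), and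
`χ̌_v = μ_v²`»).

* §1 `IsRestrictedMultilinear.map_eq_zero_of_subsingleton`, `IsRestrictedTensorProduct.subsingleton_of_subsingleton` — a
  restricted-multilinear map with a zero slot is zero; a restricted tensor product `⊗'_i (V_i, x₀_i)` with one `V_{i₀} = 0` is
  the zero module (the ranges of the structure maps `liftFinset S` exhaust `W` and are all zero).
* §2 `IsRestrictedTensorProductRep.subsingleton_centralCoinv`, `finiteAdeleRep_centralCoinv_subsingleton` — the central
  `χ = ∏χ_v`-coinvariants `Coinv(π ∘ Πʳφ, χ)` of a restricted tensor product representation vanish as soon as one local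
  quotient `Coinv(ρ_{v₀} ∘ φ_{v₀}, χ_{v₀})` vanishes (the tree's `isRestrictedTensorProduct_centralCoinv` at the comparison map
  of `exists_centralCoinvMap`, then §1).
* §3 `FinLocalSplittings.omegaPi_centralCoinv_subsingleton`, `FinLocalSplittings.omega_centralCoinv_subsingleton` — the Weil
  instance: for a family `𝓢` of local splittings and a central restricted sub-family `φ_v`, the coinvariants
  `Coinv(Ω_Π ∘ Πʳφ, χ)` of `Ω_Π = ⊗'_v ω_v`, and their pull-back `Coinv(Ω_Π ∘ Πʳφ ∘ ζ, χ ∘ ζ)` along any surjection `ζ`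
  (`TwistedCoinv.ker_comp_of_surjective`), are zero as soon as one local quotient `Coinv(ω_{v₀} ∘ φ_{v₀}, χ_{v₀})` is.

Consumer: `Liu2021/Def411WeilCarriersIrreducibleOrZeroAtLine.lean` (cell `hodgecm-mathlib`, d6 line: the registered rank-2
carrier `ω⋆` is «irreducible or zero»).  HC_CM is NOT proved by anything here.

## References
* [Flath1979] D. Flath, *Decomposition of representations into tensor products*, PSPM 33 (1979) part 1, §2, Example 2.
* [Liu2021] Y. Liu, *Fourier–Jacobi cycles and arithmetic relative trace formula*, Camb. J. Math. 9 (2021) =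
  arXiv:2102.11518: Def. 4.11 (l. 2083–2097), App. D §D.1 Steps 1–3 (l. 5214–5223), Lem. D.1 (1) (l. 5226–5229).
* [GelbartRogawski1991] S. Gelbart, J. Rogawski, Invent. Math. 105 (1991), §3.1 Prop. 3.1.1 p. 455.
-/

set_option autoImplicit false

noncomputable section

open scoped RestrictedProduct TensorProduct
open Filter Function Set IsDedekindDomain NumberField PiTensorProduct
open Literature.RepresentationTheory

namespace Literature.NumberTheory.Automorphic

universe u uk uG uH v w

/-! ### §1 A restricted tensor product with a zero factor is zero -/

section Zero

variable {ι : Type u} {k : Type uk} [CommRing k] {V : ι → Type v} [∀ i, AddCommGroup (V i)]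
  [∀ i, Module k (V i)] {x₀ : ∀ i, V i} {W : Type w} [AddCommGroup W] [Module k W] [DecidableEq ι]
  {j : RestrictedFamily V x₀ → W}

/-- **A restricted-multilinear map with a zero slot is identically zero**: if `V i₀ = 0` then every restricted family
`x` has `x i₀ = 0 = 0 • x i₀`, so `j x = 0 • j x = 0` by homogeneity in the slot `i₀`. [cite: Flath1979, §2] -/
theorem IsRestrictedMultilinear.map_eq_zero_of_subsingleton (hj : IsRestrictedMultilinear k j) (i₀ : ι)
    [Subsingleton (V i₀)] (x : RestrictedFamily V x₀) : j x = 0 := by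
  have h0 : (0 : k) • x i₀ = x i₀ := Subsingleton.elim _ _
  have hx : x = x.update i₀ ((0 : k) • x i₀) := by
    ext i
    rw [RestrictedFamily.update_apply, h0, Function.update_eq_self]
  calc j x = j (x.update i₀ ((0 : k) • x i₀)) := congrArg j hx
    _ = (0 : k) • j (x.update i₀ (x i₀)) := hj.map_update_smul x i₀ 0 (x i₀)
    _ = 0 := zero_smul _ _

/-- the structure maps `liftFinset S : ⨂_{i ∈ S} V i → W` of a restricted-multilinear map with a zero slot vanish.
[cite: Flath1979, §2] -/
theorem IsRestrictedMultilinear.liftFinset_eq_zero_of_subsingleton (hj : IsRestrictedMultilinear k j) (i₀ : ι)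
    [Subsingleton (V i₀)] (S : Finset ι) (t : ⨂[k] i : S, V i) : hj.liftFinset S t = 0 := by
  induction t using PiTensorProduct.induction_on with
  | smul_tprod r m => rw [map_smul, hj.liftFinset_tprod, hj.map_eq_zero_of_subsingleton i₀, smul_zero]
  | add x y hx hy => rw [map_add, hx, hy, add_zero]

/-- **A restricted tensor product `⊗'_i (V_i, x₀_i)` with ONE zero factor `V_{i₀} = 0` is the zero module**: the ranges
of the structure maps `liftFinset S` exhaust `W` (`⨆_S range = ⊤`) and each is zero. [cite: Flath1979, §2] -/
theorem IsRestrictedTensorProduct.subsingleton_of_subsingleton {S₀ : Finset ι} (h : IsRestrictedTensorProduct k j S₀)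
    (i₀ : ι) [Subsingleton (V i₀)] : Subsingleton W := by
  have hsup := h.iSup_range_liftFinset
  have hzero : ∀ S : Finset ι, LinearMap.range (h.isRestrictedMultilinear.liftFinset S) = ⊥ := fun S =>
    LinearMap.range_eq_bot.2 (LinearMap.ext (h.isRestrictedMultilinear.liftFinset_eq_zero_of_subsingleton i₀ S))
  simp_rw [hzero, iSup_bot] at hsup
  refine subsingleton_of_forall_eq 0 fun w => ?_
  have hw : w ∈ (⊥ : Submodule k W) := hsup ▸ Submodule.mem_top
  rwa [Submodule.mem_bot] at hw

end Zero

/-! ### §2 Central coinvariants with a vanishing local quotient vanish -/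

section Central

variable {ι : Type u} {k : Type uk} [Field k] {G : ι → Type uG} [∀ i, Group (G i)]
  {K : ∀ i, Subgroup (G i)} {H : ι → Type uH} [∀ i, Group (H i)] {KH : ∀ i, Subgroup (H i)}
  {V : ι → Type v} [∀ i, AddCommGroup (V i)] [∀ i, Module k (V i)]
  {ρ : ∀ i, Representation k (G i) (V i)} {x₀ : ∀ i, V i} [DecidableEq ι]
  {W : Type w} [AddCommGroup W] [Module k W] {j : RestrictedFamily V x₀ → W} {S₀ : Finset ι}
  {hx₀ : ∀ᶠ i in cofinite, x₀ i ∈ (ρ i).fixedPoints (K i)}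
  {π : Representation k (Πʳ i, [G i, K i]) W}
  {φ : ∀ i, H i →* G i} {hφ : ∀ᶠ i in cofinite, MapsTo (φ i) (KH i) (K i)}
  {χloc : ∀ i, H i →* kˣ}

/-- **Central coinvariants of a restricted tensor product representation VANISH as soon as ONE local quotient vanishes.**
For `(W, π, j) = ⊗'_v (ρ_v, x₀_v)`, homomorphisms `φ_v : H_v →* G_v` (`φ_v(KH_v) ⊆ K_v` a.e.), local characters `χ_v` trivial
on `KH_v` a.e., `χ = ∏_v χ_v`, and a finite `S₁` off which `[x₀_v] ≠ 0`: if the local quotient `Coinv(ρ_{v₀} ∘ φ_{v₀}, χ_{v₀})`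
is zero for some `v₀`, then `Coinv(π ∘ Πʳφ, χ) = 0` — it is `⊗'_v Coinv(ρ_v ∘ φ_v, χ_v)` (the tree's
`isRestrictedTensorProduct_centralCoinv` at the comparison map of `exists_centralCoinvMap`), and a restricted tensor
product with a zero factor is zero (§1).  Necessarily `v₀ ∈ S₁`. [cite: Flath1979, §2  Example 2] -/
theorem IsRestrictedTensorProductRep.subsingleton_centralCoinv
    (h : IsRestrictedTensorProductRep ρ π hx₀ j S₀) (χ : (Πʳ i, [H i, KH i]) →* kˣ)
    (hχ : ∀ g : Πʳ i, [H i, KH i], ((χ g : kˣ) : k) = ∏ᶠ i, ((χloc i (g i) : kˣ) : k))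
    (hχK : ∀ᶠ i in cofinite, ∀ g ∈ KH i, χloc i g = 1)
    {S₁ : Finset ι}
    (hx₀N : ∀ i ∉ S₁,
      TwistedCoinv.mk (show Representation k (H i) (V i) from (ρ i).comp (φ i)) (χloc i) (x₀ i) ≠ 0)
    (i₀ : ι)
    [Subsingleton (TwistedCoinv.Coinv (show Representation k (H i₀) (V i₀) from (ρ i₀).comp (φ i₀)) (χloc i₀))] :
    Subsingleton (TwistedCoinv.Coinv (π.comp (RestrictedProduct.mapAlongMonoidHom H G id Filter.tendsto_id φ hφ)) χ) := by
  obtain ⟨J, hJ⟩ := h.exists_centralCoinvMap (φ := φ) (hφ := hφ) (χloc := χloc)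
    (hq := Filter.Eventually.of_forall fun _ => rfl) χ hχ
  exact (h.isRestrictedTensorProduct_centralCoinv χ hχ hχK hx₀N J hJ).subsingleton_of_subsingleton i₀

end Central

/-! ### §2b The place-assembled finite-adelic representation -/

section Weil

variable (K : Type) [Field K] [NumberField K] (ι : Type) [Fintype ι] [DecidableEq (HeightOneSpectrum (𝓞 K))]
  {G : HeightOneSpectrum (𝓞 K) → Type uG} [∀ v, Group (G v)] {Kc : ∀ v, Subgroup (G v)}
  (r : ∀ v, Representation ℂ (G v) ↥(SchwartzBruhat (ι → v.adicCompletion K)))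
  (hK : ∀ᶠ v in cofinite, unitVec K ι v ∈ (r v).fixedPoints (Kc v))
  {H : HeightOneSpectrum (𝓞 K) → Type uH} [∀ v, Group (H v)] {KH : ∀ v, Subgroup (H v)}
  (φ : ∀ v, H v →* G v) (hφ : ∀ᶠ v in cofinite, MapsTo (φ v) (KH v) (Kc v))
  {χloc : ∀ v, H v →* ℂˣ}

/-- **`Coinv(⊗'_v r_v ∘ Πʳφ, ∏χ_v) = 0` as soon as ONE local quotient `Coinv(r_{v₀} ∘ φ_{v₀}, χ_{v₀})` is zero**, for the
tree's place-assembled `finiteAdeleRep K ι r hK` on `𝒮((𝔸_{K,f})^ι)` (`subsingleton_centralCoinv` at the certificate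
`isRestrictedTensorProductRep_finiteAdeleRep`). [cite: Flath1979, §2  Example 2] -/
theorem finiteAdeleRep_centralCoinv_subsingleton (χ : (Πʳ v, [H v, KH v]) →* ℂˣ)
    (hχ : ∀ g : Πʳ v, [H v, KH v], ((χ g : ℂˣ) : ℂ) = ∏ᶠ v, ((χloc v (g v) : ℂˣ) : ℂ))
    (hχK : ∀ᶠ v in cofinite, ∀ g ∈ KH v, χloc v g = 1)
    {S₁ : Finset (HeightOneSpectrum (𝓞 K))}
    (hx₀N : ∀ v ∉ S₁,
      TwistedCoinv.mk (show Representation ℂ (H v) _ from (r v).comp (φ v)) (χloc v) (unitVec K ι v) ≠ 0)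
    (v₀ : HeightOneSpectrum (𝓞 K))
    [Subsingleton (TwistedCoinv.Coinv (show Representation ℂ (H v₀) _ from (r v₀).comp (φ v₀)) (χloc v₀))] :
    Subsingleton (TwistedCoinv.Coinv
      ((finiteAdeleRep K ι r hK).comp (RestrictedProduct.mapAlongMonoidHom H G id Filter.tendsto_id φ hφ)) χ) :=
  (isRestrictedTensorProductRep_finiteAdeleRep K ι r hK).subsingleton_centralCoinv χ hχ hχK hx₀N v₀

end Weil

end Literature.NumberTheory.Automorphic

/-! ### §3 The finite Weil representation of a unitary group assembled from local splittings -/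

namespace Literature.NumberTheory.GelbartRogawski1991.UnitaryDualPair.LocalSplitting.FinLocalSplittings

open scoped Classical
open Literature.NumberTheory.Automorphic

universe uH

variable {F : Type} [Field F] [NumberField F] {E : Type} [Field E] [NumberField E] [Algebra F E]
  [Algebra.IsQuadraticExtension F E] {c : E ≃ₐ[F] E} {N : ℕ} {δ : E} {hcδ : c δ = -δ} {hδ : δ ≠ 0} {d : F}
  {hd : δ * δ = algebraMap F E d} {T : Matrix (Fin N) (Fin N) F} {hT : T.IsSymm}
  {J : Matrix (Fin N) (Fin N) E} {hJ : J = T.map (algebraMap F E)}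
  (𝓢 : FinLocalSplittings F E c N hcδ hδ hd T hT hJ)
  {H : HeightOneSpectrum (𝓞 F) → Type uH} [∀ v, Group (H v)] {KH : ∀ v, Subgroup (H v)}
  (φ : ∀ v, H v →* UnitaryGroup.localPi E c N J v)
  (hφ : ∀ᶠ v in cofinite, MapsTo (φ v) (KH v) (UnitaryGroup.localInt E c N J v))
  {χloc : ∀ v, H v →* ℂˣ}

/-- **[Liu2021, Def. 4.11] at rank `n = 2`, the ZERO case, on the tree's Weil carrier.**  For a family of local
splittings `𝓢` (`s_v : U(J)(F_v) →* S̃p_{ψ_v}(𝕎_v)`, Liu's `ι_{μ_v}`), a restricted sub-family `φ_v : H_v →* U(J)(F_v)`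
(e.g. the local centre `E_v¹`), local characters `χ_v` trivial on `KH_v` almost everywhere, `χ = ∏_v χ_v`, and the
unramified vector surviving off a finite `S₁`: if ONE local maximal `χ_{v₀}`-quotient `Coinv(ω_{v₀} ∘ φ_{v₀}, χ_{v₀})` is
ZERO ([Liu2021, App. D Lem. D.1 (1)]: at `n = 2`, `E_{v₀}` a field, `V_{v₀}` anisotropic, `χ̌_{v₀} = μ_{v₀}²`), then the
coinvariants `Coinv(Ω_Π ∘ Πʳφ, χ)` of `Ω_Π = ⊗'_v ω_v` — «`ω(μ, ε, χ) := ⊗'_v ω(μ_v, ε_v, χ_v)`» — are ZERO.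
[cite: Liu2021, Def. 4.11 (l. 2092–2096), App. D Lem. D.1 (1) (l. 5229); Flath1979, §2  Example 2] -/
theorem omegaPi_centralCoinv_subsingleton (χ : (Πʳ v, [H v, KH v]) →* ℂˣ)
    (hχ : ∀ g : Πʳ v, [H v, KH v], ((χ g : ℂˣ) : ℂ) = ∏ᶠ v, ((χloc v (g v) : ℂˣ) : ℂ))
    (hχK : ∀ᶠ v in cofinite, ∀ g ∈ KH v, χloc v g = 1)
    {S₁ : Finset (HeightOneSpectrum (𝓞 F))}
    (hx₀N : ∀ v ∉ S₁,
      TwistedCoinv.mk (show Representation ℂ (H v) _ from (𝓢.omegaLoc v).comp (φ v)) (χloc v) (unitVec F (Fin N) v)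
        ≠ 0)
    (v₀ : HeightOneSpectrum (𝓞 F))
    [Subsingleton (TwistedCoinv.Coinv (show Representation ℂ (H v₀) _ from (𝓢.omegaLoc v₀).comp (φ v₀)) (χloc v₀))] :
    Subsingleton (TwistedCoinv.Coinv
      (𝓢.OmegaPi.comp (RestrictedProduct.mapAlongMonoidHom H (fun v => UnitaryGroup.localPi E c N J v) id
        Filter.tendsto_id φ hφ)) χ) :=
  finiteAdeleRep_centralCoinv_subsingleton F (Fin N) 𝓢.omegaLoc 𝓢.unitVec_mem_fixedPoints φ hφ χ hχ hχK hx₀N v₀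

/-- **The same read through any surjection `ζ : W ↠ Πʳ_v [H_v, KH_v]` presenting the acting group** (e.g. `W = E¹(𝔸_{F,f})`
through its restricted-product decomposition; the `U(J)(𝔸_{F,f})`-action `Ω = Ω_Π ∘ finAdelicEquiv` plays no role for the
carrier): `Coinv(Ω_Π ∘ Πʳφ ∘ ζ, χ ∘ ζ)` is the quotient by the SAME submodule (`TwistedCoinv.ker_comp_of_surjective`), hence
ZERO as soon as one local quotient is. [cite: Liu2021, Def. 4.11 (l. 2092–2096), App. D Lem. D.1 (1) (l. 5229); Flath1979, §2  Example 2] -/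
theorem omega_centralCoinv_subsingleton (χ : (Πʳ v, [H v, KH v]) →* ℂˣ)
    (hχ : ∀ g : Πʳ v, [H v, KH v], ((χ g : ℂˣ) : ℂ) = ∏ᶠ v, ((χloc v (g v) : ℂˣ) : ℂ))
    (hχK : ∀ᶠ v in cofinite, ∀ g ∈ KH v, χloc v g = 1)
    {S₁ : Finset (HeightOneSpectrum (𝓞 F))}
    (hx₀N : ∀ v ∉ S₁,
      TwistedCoinv.mk (show Representation ℂ (H v) _ from (𝓢.omegaLoc v).comp (φ v)) (χloc v) (unitVec F (Fin N) v)
        ≠ 0)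
    (v₀ : HeightOneSpectrum (𝓞 F))
    [Subsingleton (TwistedCoinv.Coinv (show Representation ℂ (H v₀) _ from (𝓢.omegaLoc v₀).comp (φ v₀)) (χloc v₀))]
    {W : Type*} [Group W] (ζ : W →* Πʳ v : HeightOneSpectrum (𝓞 F), [H v, KH v]) (hζ : Function.Surjective ζ) :
    Subsingleton (TwistedCoinv.Coinv
      (show Representation ℂ W _ from
        (𝓢.OmegaPi.comp (RestrictedProduct.mapAlongMonoidHom H (fun v => UnitaryGroup.localPi E c N J v) id
          Filter.tendsto_id φ hφ)).comp ζ) (χ.comp ζ)) := by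
  have h1 := 𝓢.omegaPi_centralCoinv_subsingleton φ hφ χ hχ hχK hx₀N v₀
  rw [TwistedCoinv.Coinv, Submodule.Quotient.subsingleton_iff] at h1 ⊢
  rw [TwistedCoinv.ker_comp_of_surjective _ χ ζ hζ, h1]

end Literature.NumberTheory.GelbartRogawski1991.UnitaryDualPair.LocalSplitting.FinLocalSplittings

end
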